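import Literature.Probability.RandomPlanarGeometry.SLE
import Literature.Probability.RandomPlanarGeometry.SLEExistenceConverse
import Literature.Probability.RandomPlanarGeometry.CritPercSLE
import Literature.Probability.RandomPlanarGeometry.CurveSpace
import HarnessLib

/-!
# `stub_sleAreaLawGlue`: the two-sided `r²` law for SLE_{8/3} laws at a flat wall point, from the
# half-plane law and the flat-window transport (measure bookkeeping)

Stub N1b `stub_sleAreaLawGlue` of the registered skeleton of the line `boundary-area-law` for the
crux `SubseqIdentification` (stmt-CriticalPhenomena-0783, route `SAWRenewalTightness`; primary
decl `SAWParafermion.SubseqIdentification`), necessity package. It is the forward twin of the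
landed glue `stub_kappaPinGlue` (`…SubseqIdentificationKappaPinGlue.lean`).

The statement is an implication `N1a → (window transport) → N1`:
* N1a (first hypothesis, the neighbour stub `stub_sleHalfPlaneAreaLaw`): given `HasSLETrace (8/3)`
  and a real point `u₀ ≠ 0`, the SLE_{8/3} trace `γ` in `ℍ` satisfies a two-sided `ρ²` law
  `c ρ² ≤ P[dist(u₀, γ[0,∞)) < ρ]`, `P[dist(u₀, γ[0,∞)) ≤ ρ] ≤ C ρ²` for `0 < ρ ≤ ρ₀`;
* second hypothesis (the landed stub `stub_windowTransport`): for a Dobrushin domain with a flat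
  horizontal window at `x₀ ∉ {a, b}` and a chordal uniformizing map `φ`, the boundary extension
  `Φ` of `φ` is two-sidedly Lipschitz at one real point `u₀ ≠ 0` relative to the closed
  half-plane, with `Φ(u₀) = x₀` in the quantitative sense displayed;
* N1 (conclusion): every SLE_{8/3} law `μ` of such a domain satisfies the two-sided `r²` law
  `c' r² ≤ μ[dist(x₀, trace) < r]`, `μ[dist(x₀, trace) ≤ r] ≤ C' r²` for `0 < r ≤ r₀`.

Proof (pure bookkeeping, the proof of `stub_kappaPinGlue` run forwards). Unfold
`IsSLELaw (8/3) D μ` to `μ = P.map Γ` with, almost surely, `Γ ω = CurveClass.mk c_ω` and `c_ω` the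
time-compactified image of `sleTrace (8/3) ω` under `Φ` ending at `b = D.pt 1` (`IsSLECurve`,
`IsCompactifiedImage`); the trace theorem `HasSLETrace (8/3)` needed by N1a is
`IsSLELaw.hasSLETrace`. Deterministically, for such `c` (the trace lies in the closed half-plane,
`sleTrace_im_nonneg`): if `dist(u₀, range γ) < ρ ≤ η` then `dist(x₀, range c) < L ρ`, and if
`dist(x₀, range c) ≤ r` with `r < min(η, |x₀ - b|)` then `dist(u₀, range γ) ≤ L r` (the private
transport lemmas of the sibling file, copied below). The event `{dist(x₀, ·.range) ≤ r}` is closed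
in `CurveClass ℂ` (`c ↦ infDist x₀ c.range` is `1`-Lipschitz), so `μ S = P (Γ ⁻¹' S)`
(`Measure.map_apply_of_aemeasurable`), while `P (Γ ⁻¹' S) ≤ μ S` for every `S`
(`Measure.le_map_apply`), and almost sure inclusions give inequalities of measures
(`measure_mono_ae`). Hence, for `r ≤ r₀ := min (L·min(ρ₀, η)) (min (ρ₀/L) (min(η, |x₀ - b|)/2))`,
`c (r/L)² ≤ P[dist_ℍ < r/L] ≤ μ[dist < r]` and `μ[dist ≤ r] ≤ P[dist_ℍ ≤ L r] ≤ C (L r)²`: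
the law holds at `x₀` with constants `(c/L², C L², r₀)`.

No named fact is used beyond the two displayed hypotheses.
-/

open MeasureTheory Filter Topology Set
open scoped NNReal ENNReal

namespace Summit.CriticalPhenomena.SAWScalingLimit.Theorems.SubseqIdentification.BoundaryAreaLaw

open Literature.Probability.RandomPlanarGeometry
open Literature.Probability.Process (preWienerMeasure)
open UpperHalfPlane (upperHalfPlaneSet)

/-! ## The distance to the trace is a Lipschitz functional on curve classes -/

-- adapted from Summits/CriticalPhenomena/SAWScalingLimit/Theorems/SAWRenewalTightnessSubseqIdentificationKappaPinGlue.lean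
/-- For two parametrised curves, the distance from a point to the trace of the first is at most
the distance to the trace of the second plus the reparametrisation distance of the curves
(every point of `γ₂` is within `dist γ₁ γ₂` of the trace of `γ₁`, `Curve.infDist_range_le`).
[folklore] -/
private theorem infDist_range_le_infDist_range_add (x : ℂ) (γ₁ γ₂ : Curve ℂ) :
    Metric.infDist x γ₁.range ≤ Metric.infDist x γ₂.range + dist γ₁ γ₂ := by
  refine le_of_forall_pos_lt_add fun ε hε => ?_
  obtain ⟨y, hy, hxy⟩ := (Metric.infDist_lt_iff γ₂.range_nonempty).1
    (show Metric.infDist x γ₂.range < Metric.infDist x γ₂.range + ε / 2 by linarith)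
  obtain ⟨t, rfl⟩ := Curve.mem_range.1 hy
  have ht : Metric.infDist (γ₂ t) γ₁.range < dist γ₁ γ₂ + ε / 2 :=
    (Curve.infDist_range_le γ₂ γ₁ t).trans_lt (by rw [dist_comm γ₂ γ₁]; linarith)
  obtain ⟨z, hz, htz⟩ := (Metric.infDist_lt_iff γ₁.range_nonempty).1 ht
  calc Metric.infDist x γ₁.range ≤ dist x z := Metric.infDist_le_dist_of_mem hz
    _ ≤ dist x (γ₂ t) + dist (γ₂ t) z := dist_triangle _ _ _
    _ < Metric.infDist x γ₂.range + dist γ₁ γ₂ + ε := by linarith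

-- adapted from Summits/CriticalPhenomena/SAWScalingLimit/Theorems/SAWRenewalTightnessSubseqIdentificationKappaPinGlue.lean
/-- The distance from a fixed point `x` to the trace, `c ↦ infDist x c.range`, is a `1`-Lipschitz
functional on the space `CurveClass ℂ` of curves modulo reparametrisation (pattern of
`CurveClass.lipschitzWith_source`). [folklore] -/
private theorem lipschitzWith_infDist_range (x : ℂ) :
    LipschitzWith 1 (fun c : CurveClass ℂ => Metric.infDist x c.range) :=
  LipschitzWith.mk_one fun c₁ c₂ => by
    obtain ⟨γ₁, rfl⟩ := CurveClass.surjective_mk c₁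
    obtain ⟨γ₂, rfl⟩ := CurveClass.surjective_mk c₂
    simp only [CurveClass.dist_mk_mk, CurveClass.range_mk]
    rw [Real.dist_eq, abs_sub_le_iff]
    have h₁ := infDist_range_le_infDist_range_add x γ₁ γ₂
    have h₂ := infDist_range_le_infDist_range_add x γ₂ γ₁
    rw [dist_comm γ₂ γ₁] at h₂
    constructor <;> linarith

-- adapted from Summits/CriticalPhenomena/SAWScalingLimit/Theorems/SAWRenewalTightnessSubseqIdentificationKappaPinGlue.lean
/-- The event "the trace comes within distance `≤ r` of `x`" is a Borel set of `CurveClass ℂ`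
(a closed set, sublevel set of a continuous functional). [folklore] -/
private theorem measurableSet_infDist_range_le (x : ℂ) (r : ℝ) :
    MeasurableSet {c : CurveClass ℂ | Metric.infDist x c.range ≤ r} :=
  (isClosed_le (lipschitzWith_infDist_range x).continuous continuous_const).measurableSet

/-! ## Deterministic transport through the compactified image -/

-- adapted from Summits/CriticalPhenomena/SAWScalingLimit/Theorems/SAWRenewalTightnessSubseqIdentificationKappaPinGlue.lean
/-- Approximation step: if `a < ρ'` forces `d < L ρ'` for every level `ρ' ≤ η`, then `a ≤ ρ`
with `ρ < η` forces `d ≤ L ρ` (`L > 0`). [folklore] -/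
private theorem le_mul_of_forall_lt {a d L η ρ : ℝ} (hL : 0 < L) (hρ : ρ < η)
    (h : ∀ ρ' : ℝ, ρ' ≤ η → a < ρ' → d < L * ρ') (ha : a ≤ ρ) : d ≤ L * ρ := by
  refine le_of_forall_pos_lt_add fun ε hε => ?_
  have hlt : ρ < min (ρ + ε / L) η := lt_min (lt_add_of_pos_right ρ (div_pos hε hL)) hρ
  calc d < L * min (ρ + ε / L) η := h _ (min_le_right _ _) (ha.trans_lt hlt)
    _ ≤ L * (ρ + ε / L) := by gcongr; exact min_le_left _ _
    _ = L * ρ + ε := by rw [mul_add, mul_div_cancel₀ _ hL.ne']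

section Transport

variable {Φ : ℂ → ℂ} {γ : ℝ≥0 → ℂ} {b x₀ : ℂ} {c : Curve ℂ} {u₀ L η : ℝ}

-- adapted from Summits/CriticalPhenomena/SAWScalingLimit/Theorems/SAWRenewalTightnessSubseqIdentificationKappaPinGlue.lean
/-- **Transport `ℍ → D`, strict form.** If the half-plane curve `γ` (in the closed half-plane)
comes within distance `< ρ ≤ η` of `u₀`, then its compactified image `c` under `Φ` comes within
distance `< L ρ` of `x₀`, by the Lipschitz bound of `Φ` at `u₀`. [folklore] -/
private theorem infDist_image_lt (hc : IsCompactifiedImage Φ γ b c) (him : ∀ t, 0 ≤ (γ t).im)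
    (hL : 0 < L)
    (hLip : ∀ u : ℂ, 0 ≤ u.im →
      (dist u (u₀ : ℂ) < η → dist (Φ u) x₀ ≤ L * dist u (u₀ : ℂ)) ∧
        (dist (Φ u) x₀ < η → dist u (u₀ : ℂ) ≤ L * dist (Φ u) x₀))
    {ρ : ℝ} (hρ : ρ ≤ η) (h : Metric.infDist (u₀ : ℂ) (Set.range γ) < ρ) :
    Metric.infDist x₀ c.range < L * ρ := by
  obtain ⟨y, hy, hty⟩ := (Metric.infDist_lt_iff (Set.range_nonempty γ)).1 h
  obtain ⟨t, rfl⟩ := Set.mem_range.1 hy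
  rw [dist_comm] at hty
  obtain ⟨s, hs, hst⟩ := exists_rayParam_eq t
  have hmem : Φ (γ t) ∈ c.range := Curve.mem_range.2 ⟨s, by rw [hc.1 s hs, hst]⟩
  calc Metric.infDist x₀ c.range ≤ dist x₀ (Φ (γ t)) := Metric.infDist_le_dist_of_mem hmem
    _ = dist (Φ (γ t)) x₀ := dist_comm _ _
    _ ≤ L * dist (γ t) (u₀ : ℂ) := (hLip (γ t) (him t)).1 (hty.trans_le hρ)
    _ < L * ρ := by gcongr

-- adapted from Summits/CriticalPhenomena/SAWScalingLimit/Theorems/SAWRenewalTightnessSubseqIdentificationKappaPinGlue.lean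
/-- **Transport `D → ℍ`, strict form.** If the compactified image `c` comes within distance
`< r` of `x₀`, where `r ≤ η` and `r ≤ dist x₀ b`, then the witnessing point of `c` is not the
endpoint `b`, hence is `Φ (γ t)` for some `t`, and `γ` comes within distance `< L r` of `u₀` by
the reverse Lipschitz bound. [folklore] -/
private theorem infDist_range_lt (hc : IsCompactifiedImage Φ γ b c) (him : ∀ t, 0 ≤ (γ t).im)
    (hL : 0 < L)
    (hLip : ∀ u : ℂ, 0 ≤ u.im →
      (dist u (u₀ : ℂ) < η → dist (Φ u) x₀ ≤ L * dist u (u₀ : ℂ)) ∧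
        (dist (Φ u) x₀ < η → dist u (u₀ : ℂ) ≤ L * dist (Φ u) x₀))
    {r : ℝ} (hr : r ≤ η) (hrb : r ≤ dist x₀ b) (h : Metric.infDist x₀ c.range < r) :
    Metric.infDist (u₀ : ℂ) (Set.range γ) < L * r := by
  obtain ⟨y, hy, hsy⟩ := (Metric.infDist_lt_iff c.range_nonempty).1 h
  obtain ⟨s, rfl⟩ := Curve.mem_range.1 hy
  rcases (unitInterval.le_one s).lt_or_eq with hs1 | hs1
  · rw [hc.1 s hs1, dist_comm] at hsy
    calc Metric.infDist (u₀ : ℂ) (Set.range γ) ≤ dist (u₀ : ℂ) (γ (rayParam s)) :=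
          Metric.infDist_le_dist_of_mem (Set.mem_range_self _)
      _ = dist (γ (rayParam s)) (u₀ : ℂ) := dist_comm _ _
      _ ≤ L * dist (Φ (γ (rayParam s))) x₀ := (hLip _ (him _)).2 (hsy.trans_le hr)
      _ < L * r := by gcongr
  · rw [Set.Icc.coe_eq_one.1 hs1, hc.2] at hsy
    exact absurd (hsy.trans_le hrb) (lt_irrefl _)

-- adapted from Summits/CriticalPhenomena/SAWScalingLimit/Theorems/SAWRenewalTightnessSubseqIdentificationKappaPinGlue.lean
/-- **Transport `D → ℍ`, non-strict form**: `dist(x₀, range c) ≤ r` with `r < η` and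
`r < dist x₀ b` gives `dist(u₀, range γ) ≤ L r`. [folklore] -/
private theorem infDist_range_le_mul (hc : IsCompactifiedImage Φ γ b c)
    (him : ∀ t, 0 ≤ (γ t).im) (hL : 0 < L)
    (hLip : ∀ u : ℂ, 0 ≤ u.im →
      (dist u (u₀ : ℂ) < η → dist (Φ u) x₀ ≤ L * dist u (u₀ : ℂ)) ∧
        (dist (Φ u) x₀ < η → dist u (u₀ : ℂ) ≤ L * dist (Φ u) x₀))
    {r : ℝ} (hr : r < η) (hrb : r < dist x₀ b) (h : Metric.infDist x₀ c.range ≤ r) :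
    Metric.infDist (u₀ : ℂ) (Set.range γ) ≤ L * r :=
  le_mul_of_forall_lt hL (lt_min hr hrb)
    (fun _ hr' h' => infDist_range_lt hc him hL hLip (hr'.trans (min_le_left _ _))
      (hr'.trans (min_le_right _ _)) h') h

end Transport

/-! ## The glue -/

/-- **N1b — the glue `N1a → (window transport) → N1` of the line `boundary-area-law`** (crux
`SubseqIdentification`, stmt-CriticalPhenomena-0783, necessity package). From the half-plane
two-sided `ρ²` law at a real point `u₀ ≠ 0` for the distance of the SLE_{8/3} trace to `u₀`
(first hypothesis) and the flat-window transport (second hypothesis: the boundary extension of a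
chordal uniformizing map of a Dobrushin domain with a flat horizontal window at `x₀ ∉ {a, b}` is
two-sidedly Lipschitz at some real `u₀ ≠ 0` over `x₀`), every SLE_{8/3} law `μ` of such a domain
satisfies the two-sided law `c r² ≤ μ[dist(x₀, trace) < r]`, `μ[dist(x₀, trace) ≤ r] ≤ C r²` for
`0 < r ≤ r₀`. Proof: `μ = P.map Γ` with a.s. `Γ ω` the class of the compactified image of
`sleTrace (8/3) ω` (`IsSLELaw`, `IsSLECurve`, `IsCompactifiedImage`, `IsSLELaw.hasSLETrace`); the
event `{dist(x₀, ·.range) ≤ r}` is closed (the functional is `1`-Lipschitz), the a.s. transport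
of distances (`infDist_image_lt`, `infDist_range_le_mul`) sandwiches the `D`-events between
`ℍ`-events up to null sets, and `Measure.le_map_apply` / `Measure.map_apply_of_aemeasurable` /
`measure_mono_ae` move the `ρ²` law from `u₀` to `x₀` with constants `c/L²`, `C L²` and radius
`r₀ = min (L·min(ρ₀, η)) (min (ρ₀/L) (min(η, |x₀ - b|)/2))`. [folklore] -/
theorem stub_sleAreaLawGlue :
    (HasSLETrace ((8 : ℝ≥0) / 3) → ∀ (u₀ : ℝ), u₀ ≠ 0 →
      ∃ c C ρ₀ : ℝ, 0 < c ∧ 0 < C ∧ 0 < ρ₀ ∧ ∀ ρ : ℝ, 0 < ρ → ρ ≤ ρ₀ →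
        ENNReal.ofReal (c * ρ ^ 2) ≤
            preWienerMeasure {ω | Metric.infDist (u₀ : ℂ) (Set.range (sleTrace ((8 : ℝ≥0) / 3) ω)) < ρ} ∧
          preWienerMeasure {ω | Metric.infDist (u₀ : ℂ) (Set.range (sleTrace ((8 : ℝ≥0) / 3) ω)) ≤ ρ} ≤
            ENNReal.ofReal (C * ρ ^ 2)) →
    (∀ (D : DobrushinDomain) (x₀ : ℂ) (ρ₀ : ℝ), 0 < ρ₀ →
      D.carrier ∩ Metric.ball x₀ ρ₀ = {z : ℂ | x₀.im < z.im} ∩ Metric.ball x₀ ρ₀ →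
      x₀ ≠ D.pt 0 → x₀ ≠ D.pt 1 →
      ∀ (φ : ConformalEquiv upperHalfPlaneSet D.carrier), D.IsChordalUniformizing φ →
        ∃ u₀ L η : ℝ, u₀ ≠ 0 ∧ 0 < L ∧ 0 < η ∧
          ∀ u : ℂ, 0 ≤ u.im →
            (dist u (u₀ : ℂ) < η →
                dist (φ.boundaryExtension u) x₀ ≤ L * dist u (u₀ : ℂ)) ∧
            (dist (φ.boundaryExtension u) x₀ < η →
                dist u (u₀ : ℂ) ≤ L * dist (φ.boundaryExtension u) x₀)) →
    ∀ (D : DobrushinDomain) (μ : Measure (CurveClass ℂ)) (x₀ : ℂ) (ρ₀ : ℝ),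
      IsSLELaw ((8 : ℝ≥0) / 3) D μ → 0 < ρ₀ →
      D.carrier ∩ Metric.ball x₀ ρ₀ = {z : ℂ | x₀.im < z.im} ∩ Metric.ball x₀ ρ₀ →
      x₀ ≠ D.pt 0 → x₀ ≠ D.pt 1 →
      ∃ c C r₀ : ℝ, 0 < c ∧ 0 < C ∧ 0 < r₀ ∧ ∀ r : ℝ, 0 < r → r ≤ r₀ →
        ENNReal.ofReal (c * r ^ 2) ≤ μ {γ | Metric.infDist x₀ γ.range < r} ∧
          μ {γ | Metric.infDist x₀ γ.range ≤ r} ≤ ENNReal.ofReal (C * r ^ 2) := by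
  intro hhp htr D μ x₀ ρ₀ hμ hρ₀ hwin hx0 hx1
  have hT : HasSLETrace ((8 : ℝ≥0) / 3) := hμ.hasSLETrace
  obtain ⟨Γ, ⟨hΓ, φ, hφ, hae⟩, rfl⟩ := hμ
  obtain ⟨u₀, L, η, hu₀, hL, hη, hLip⟩ := htr D x₀ ρ₀ hρ₀ hwin hx0 hx1 φ hφ
  obtain ⟨c, C, ρ₁, hc, hC, hρ₁, hlaw⟩ := hhp hT u₀ hu₀
  have hb : 0 < dist x₀ (D.pt 1) := dist_pos.2 hx1
  -- the almost sure transport of distances between the trace in `ℍ` and the curve in `D`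
  have hgood : ∀ᵐ ω ∂preWienerMeasure,
      (∀ ρ : ℝ, ρ ≤ η →
          Metric.infDist (u₀ : ℂ) (Set.range (sleTrace ((8 : ℝ≥0) / 3) ω)) < ρ →
          Metric.infDist x₀ (Γ ω).range < L * ρ) ∧
        ∀ r : ℝ, r < η → r < dist x₀ (D.pt 1) → Metric.infDist x₀ (Γ ω).range ≤ r →
          Metric.infDist (u₀ : ℂ) (Set.range (sleTrace ((8 : ℝ≥0) / 3) ω)) ≤ L * r := by
    filter_upwards [hae] with ω hω
    obtain ⟨-, c, hΓω, hc⟩ := hω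
    rw [hΓω, CurveClass.range_mk]
    exact ⟨fun ρ hρ h => infDist_image_lt hc (sleTrace_im_nonneg _ ω) hL hLip hρ h,
      fun r hr hrb h => infDist_range_le_mul hc (sleTrace_im_nonneg _ ω) hL hLip hr hrb h⟩
  have hm : 0 < min η (dist x₀ (D.pt 1)) := lt_min hη hb
  refine ⟨c / L ^ 2, C * L ^ 2,
    min (L * min ρ₁ η) (min (ρ₁ / L) (min η (dist x₀ (D.pt 1)) / 2)),
    div_pos hc (pow_pos hL 2), mul_pos hC (pow_pos hL 2),
    lt_min (mul_pos hL (lt_min hρ₁ hη)) (lt_min (div_pos hρ₁ hL) (half_pos hm)),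
    fun r hr0 hr1 => ?_⟩
  -- the smallness conditions on `r`
  have hrL : r / L ≤ min ρ₁ η :=
    (div_le_iff₀' hL).2 (hr1.trans (min_le_left _ _))
  have hLr : L * r ≤ ρ₁ :=
    (le_div_iff₀' hL).1 ((hr1.trans (min_le_right _ _)).trans (min_le_left _ _))
  have hrm : r < min η (dist x₀ (D.pt 1)) :=
    ((hr1.trans (min_le_right _ _)).trans (min_le_right _ _)).trans_lt (half_lt_self hm)
  have hrη : r < η := hrm.trans_le (min_le_left _ _)
  have hrd : r < dist x₀ (D.pt 1) := hrm.trans_le (min_le_right _ _)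
  constructor
  · -- lower bound: `c (r/L)² ≤ P[dist_ℍ < r/L] ≤ P[Γ ∈ {dist < r}] ≤ μ[dist < r]`
    calc ENNReal.ofReal (c / L ^ 2 * r ^ 2) = ENNReal.ofReal (c * (r / L) ^ 2) := by
          congr 1; rw [div_pow]; ring
      _ ≤ preWienerMeasure
            {ω | Metric.infDist (u₀ : ℂ) (Set.range (sleTrace ((8 : ℝ≥0) / 3) ω)) < r / L} :=
          (hlaw _ (div_pos hr0 hL) (hrL.trans (min_le_left _ _))).1
      _ ≤ preWienerMeasure (Γ ⁻¹' {γ | Metric.infDist x₀ γ.range < r}) := by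
          refine measure_mono_ae ?_
          filter_upwards [hgood] with ω hω hlt
          show Metric.infDist x₀ (Γ ω).range < r
          calc Metric.infDist x₀ (Γ ω).range < L * (r / L) :=
                hω.1 _ (hrL.trans (min_le_right _ _)) hlt
            _ = r := mul_div_cancel₀ _ hL.ne'
      _ ≤ preWienerMeasure.map Γ {γ | Metric.infDist x₀ γ.range < r} :=
          Measure.le_map_apply hΓ _
  · -- upper bound: `μ[dist ≤ r] = P[Γ ∈ {dist ≤ r}] ≤ P[dist_ℍ ≤ L r] ≤ C (L r)²`
    calc preWienerMeasure.map Γ {γ | Metric.infDist x₀ γ.range ≤ r}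
        = preWienerMeasure (Γ ⁻¹' {γ | Metric.infDist x₀ γ.range ≤ r}) :=
          Measure.map_apply_of_aemeasurable hΓ (measurableSet_infDist_range_le x₀ _)
      _ ≤ preWienerMeasure
            {ω | Metric.infDist (u₀ : ℂ) (Set.range (sleTrace ((8 : ℝ≥0) / 3) ω)) ≤ L * r} := by
          refine measure_mono_ae ?_
          filter_upwards [hgood] with ω hω hle
          exact hω.2 _ hrη hrd hle
      _ ≤ ENNReal.ofReal (C * (L * r) ^ 2) := (hlaw _ (mul_pos hL hr0) hLr).2
      _ = ENNReal.ofReal (C * L ^ 2 * r ^ 2) := by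
          congr 1; ring

end Summit.CriticalPhenomena.SAWScalingLimit.Theorems.SubseqIdentification.BoundaryAreaLaw
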